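import Summits.PneNP.PneNP.Theorems.ChebyshevTracialDesignTightnessFree
import Summits.PneNP.PneNP.Theorems.ChebyshevTracialDesignWellConditionedDensity
import HarnessLib

/-!
# Cell pnp-psdrank, route `ChebyshevTracialDesign`: the crux `TracialDecayExp20` is EQUIVALENT to its restriction to ILL-CONDITIONED pairs
# — contraction pairs with `λ_min(X̄_t)·λ_min(Ȳ) < 64/n` (crux stmt-PneNP-19878; leaf file)

Brick 87e (prover g16; MEMO-19 §2(c)–(d)). Brick 84 (`…TightnessFree.tracialDecayExp20_iff_contractions`) states the crux as decay over ALL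
pairs of psd-contraction families in the dimension budget; brick 87d (`…WellConditionedDensity.value_le_tail_of_minDensity`) proves,
unconditionally and at EVERY dimension, that a pair whose slice sums satisfy `Σ_{|U|=t} X_U ⪰ μ·C(n,t)·I`, `Σ_M Y_M ⪰ ν·|PM|·I` with
`μν ≥ 64/n` (WELL-CONDITIONED) has design value `≤ r·(Σ|w_c|)·√P_{dq n/2+1}`. §1 (`tail_le_exp_neg`): that tail is `≤ e^{−dq n}` for
`n ≥ 15⁴` (`P ≤ (1/3000)^{D/2+1} ≤ e^{−(2D+8)}`, `20e^{−4} ≤ 1`), and (`design_side_conditions`) the side conditions `dq n ≤ 2c'`,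
`5·dq n ≤ 2c'+2`, `2c'+5·dq n ≤ n` of brick 87d hold for every balanced Chebyshev design once `n ≥ 15⁴`. Hence (§2):

  `TracialDecayExp20 ↔ ∃ a > 0, ∀ large even n, ∀ balanced B = 20 designs (t, C, w), ∀ r ≥ 1 with r²n < exp(a·dq n),
     ∀ psd-contraction families X, Y of dimension r that are ILL-CONDITIONED (there are NO μ, ν > 0 with μν ≥ 64/n,
     Σ_{|U|=t} X_U ⪰ μ·C(n,t)·I and Σ_M Y_M ⪰ ν·|PM|·I):  (1/r)·Σ_{U,M} W(U,M)·tr(X_U Y_M) ≤ exp(−a·dq n)`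
                                                                                          (`tracialDecayExp20_iff_illConditioned`).

So the OPEN content of the crux is exactly the DIRECTIONALLY SPARSE regime: pairs in which some direction of `ℝ^r` has density
`< 8/√n` under `X̄_t` or under `Ȳ` — the psd image of the sparse rectangles of the `r = 1` rung (MEMO-19 §2(d)).
[cite: Rothvoss2017, §2 (PDF pp. 5–7)] [cite: Grigoriev2001, Lemma 1.4 (PDF p. 8)] [cite: GriblingDelaatLaurent2019, §5]
[cite: CoppersmithRivlin1992, Thm. (p. 970)] [cite: BrietDadushPokutta2014, Thm. 6 (§3)]
Stature: support/instrument (a reformulation of the OPEN crux with a proved cell removed; kernel lane, no defs). WHAT THIS IS NOT: no proof or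
refutation of the crux, nothing on psd rank of P_PM(K_n), no P-vs-NP content.
-/

set_option linter.dupNamespace false -- `Summit.PneNP.PneNP.…`: summit = sub-problem (D-0017)

noncomputable section

namespace Summit.PneNP.PneNP.Theorems.ChebyshevTracialDesignIllConditionedCrux

open Finset Matrix Literature.Barriers.PneNP Literature.Combinatorics.Optimization
open Summit.PneNP.PneNP.Theorems.ChebyshevTracialDesignTightnessFree
open Summit.PneNP.PneNP.Theorems.ChebyshevTracialDesignWellConditionedDensity (value_le_tail_of_minDensity)
open Summit.PneNP.PneNP.Theorems.ChebyshevTracialDesignVirtualReduction (dq_pow_four_le dq_add_three_le_Tq)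
open Summit.PneNP.PneNP.Theorems.ChebyshevTracialDesignBoundedDim (le_dq_of_pow_le)

variable {n : ℕ}

/-! ### §1 Thresholds: the deep tail is `≤ e^{−dq n}`, and the side conditions of the well-conditioned cell -/

/-- `e⁸ ≤ 3000` and `20 ≤ e⁴`. [folklore] -/
theorem exp_bounds : Real.exp 8 ≤ 3000 ∧ (20 : ℝ) ≤ Real.exp 4 := by
  have h1 := Real.exp_one_lt_d9
  have h2 := Real.exp_one_gt_d9
  have h0 := (Real.exp_pos 1).le
  constructor
  · rw [show (8 : ℝ) = (8 : ℕ) * 1 by norm_num, Real.exp_nat_mul]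
    calc Real.exp 1 ^ 8 ≤ (2.7182818286 : ℝ) ^ 8 := pow_le_pow_left₀ h0 h1.le 8
      _ ≤ 3000 := by norm_num
  · rw [show (4 : ℝ) = (4 : ℕ) * 1 by norm_num, Real.exp_nat_mul]
    calc (20 : ℝ) ≤ (2.7182818283 : ℝ) ^ 4 := by norm_num
      _ ≤ Real.exp 1 ^ 4 := pow_le_pow_left₀ (by norm_num) h2.le 4

/-- **The deep tail is exponentially small**: for `n ≥ 15⁴`, `20·√(Π_{i ≤ dq n/2}(2i+1)/(n−2i)) ≤ e^{−dq n}`.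
[cite: CoppersmithRivlin1992, Thm. (p. 970)] -/
theorem tail_le_exp_neg (hn : 50625 ≤ n) :
    20 * Real.sqrt (∏ i ∈ range (dq n / 2 + 1), ((2 * i + 1 : ℝ) / ((n : ℝ) - 2 * i))) ≤ Real.exp (-(dq n : ℝ)) := by
  set D := dq n with hDdef
  have hD15 : 15 ≤ D := le_dq_of_pow_le (by norm_num; exact hn)
  have hD4 : D ^ 4 ≤ n := dq_pow_four_le n
  have hDn : 3001 * D + 3000 ≤ n := by
    have h1 : 15 * 15 * 15 * D ≤ D ^ 4 := by
      have : 15 * 15 * 15 * D ≤ D * D * D * D :=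
        Nat.mul_le_mul (Nat.mul_le_mul (Nat.mul_le_mul hD15 hD15) hD15) le_rfl
      calc 15 * 15 * 15 * D ≤ D * D * D * D := this
        _ = D ^ 4 := by ring
    omega
  -- every factor is at most `1/3000`
  have hfac : ∀ i ∈ range (D / 2 + 1), ((2 * i + 1 : ℝ) / ((n : ℝ) - 2 * i)) ≤ 1 / 3000 := by
    intro i hi
    have hi' := mem_range.1 hi
    have h1 : (3000 * (2 * i + 1) + 2 * i : ℝ) ≤ n := by exact_mod_cast (show 3000 * (2 * i + 1) + 2 * i ≤ n by omega)
    have hden : (0 : ℝ) < (n : ℝ) - 2 * i := by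
      have : (2 * i : ℝ) + 1 ≤ n := by exact_mod_cast (show 2 * i + 1 ≤ n by omega)
      linarith
    rw [div_le_div_iff₀ hden (by norm_num)]
    linarith
  have hfac0 : ∀ i ∈ range (D / 2 + 1), 0 ≤ ((2 * i + 1 : ℝ) / ((n : ℝ) - 2 * i)) := by
    intro i hi
    have hi' := mem_range.1 hi
    have : (2 * i : ℝ) + 1 ≤ n := by exact_mod_cast (show 2 * i + 1 ≤ n by omega)
    exact div_nonneg (by positivity) (by linarith)
  have hP : ∏ i ∈ range (D / 2 + 1), ((2 * i + 1 : ℝ) / ((n : ℝ) - 2 * i)) ≤ Real.exp (-((D : ℝ) + 4)) ^ 2 := by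
    calc ∏ i ∈ range (D / 2 + 1), ((2 * i + 1 : ℝ) / ((n : ℝ) - 2 * i))
        ≤ ∏ _i ∈ range (D / 2 + 1), (1 / 3000 : ℝ) := prod_le_prod hfac0 hfac
      _ = (1 / 3000 : ℝ) ^ (D / 2 + 1) := by rw [prod_const, card_range]
      _ ≤ (Real.exp (-8)) ^ (D / 2 + 1) := by
          refine pow_le_pow_left₀ (by norm_num) ?_ _
          rw [Real.exp_neg, one_div]
          exact inv_anti₀ (Real.exp_pos 8) exp_bounds.1
      _ = Real.exp (-(8 * ((D / 2 + 1 : ℕ) : ℝ))) := by rw [← Real.exp_nat_mul]; ring_nf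
      _ ≤ Real.exp (-(2 * ((D : ℝ) + 4))) := by
          rw [Real.exp_le_exp]
          have : (2 * D + 8 : ℝ) ≤ 8 * ((D / 2 + 1 : ℕ) : ℝ) := by
            exact_mod_cast (show 2 * D + 8 ≤ 8 * (D / 2 + 1) by omega)
          linarith
      _ = Real.exp (-((D : ℝ) + 4)) ^ 2 := by rw [sq, ← Real.exp_add]; ring_nf
  have hsqrt : Real.sqrt (∏ i ∈ range (D / 2 + 1), ((2 * i + 1 : ℝ) / ((n : ℝ) - 2 * i))) ≤ Real.exp (-((D : ℝ) + 4)) :=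
    (Real.sqrt_le_sqrt hP).trans_eq (Real.sqrt_sq (Real.exp_pos _).le)
  calc 20 * Real.sqrt (∏ i ∈ range (D / 2 + 1), ((2 * i + 1 : ℝ) / ((n : ℝ) - 2 * i)))
      ≤ 20 * Real.exp (-((D : ℝ) + 4)) := mul_le_mul_of_nonneg_left hsqrt (by norm_num)
    _ = (20 * Real.exp (-4)) * Real.exp (-(D : ℝ)) := by rw [mul_assoc, ← Real.exp_add]; ring_nf
    _ ≤ 1 * Real.exp (-(D : ℝ)) := by
        refine mul_le_mul_of_nonneg_right ?_ (Real.exp_pos _).le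
        rw [Real.exp_neg, ← div_eq_mul_inv, div_le_one (Real.exp_pos 4)]
        exact exp_bounds.2
    _ = Real.exp (-(D : ℝ)) := one_mul _

/-- **Side conditions of the well-conditioned cell for balanced Chebyshev designs**: for `n ≥ 15⁴` and a `t`-cut family with `t = 2c'+1`,
`Tq n ≤ t`, `2t + 2 ≤ n`: `dq n ≤ 2c'`, `5·dq n ≤ 2c'+2` and `2c' + 5·dq n ≤ n`. [cite: CoppersmithRivlin1992, Thm. (p. 970)] -/
theorem design_side_conditions (hn : 50625 ≤ n) {c' : ℕ} (hT : Tq n ≤ 2 * c' + 1) (ht2 : 2 * (2 * c' + 1) + 2 ≤ n) :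
    dq n ≤ 2 * c' ∧ 5 * dq n ≤ 2 * c' + 2 ∧ 2 * c' + 5 * dq n ≤ n := by
  have hD15 : 15 ≤ dq n := le_dq_of_pow_le (by norm_num; exact hn)
  have hD4 : dq n ^ 4 ≤ n := dq_pow_four_le n
  have h3 := dq_add_three_le_Tq n
  -- `5·dq n ≤ Tq n + 1 = 4⌊√n⌋ + 4`: `q = dq n = ⌊√s⌋`, `s = ⌊√n⌋`, `q² ≤ s`, `5q ≤ 4q² + 4`
  have hq : dq n * dq n ≤ Nat.sqrt n := Nat.sqrt_le (Nat.sqrt n)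
  have h5 : 5 * dq n ≤ Tq n + 1 := by
    unfold Tq
    nlinarith [hq, hD15]
  have h10 : 10 * dq n ≤ n := by
    have : 15 * 15 * 15 * dq n ≤ dq n ^ 4 := by
      calc 15 * 15 * 15 * dq n ≤ dq n * dq n * dq n * dq n :=
            Nat.mul_le_mul (Nat.mul_le_mul (Nat.mul_le_mul hD15 hD15) hD15) le_rfl
        _ = dq n ^ 4 := by ring
    omega
  refine ⟨by omega, by omega, by omega⟩

/-! ### §2 The crux restricted to ill-conditioned pairs -/

/-- **THE CRUX IS EQUIVALENT TO ITS RESTRICTION TO ILL-CONDITIONED PAIRS.** `TracialDecayExp20` holds iff, for some `a > 0` and all large even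
`n`, every balanced `B = 20` design weight has normalised value `≤ exp(−a·dq n)` on every pair of psd-contraction families of every
dimension `r ≥ 1` with `r²n < exp(a·dq n)` that is ILL-CONDITIONED: there are no `μ, ν > 0` with `μν ≥ 64/n`,
`Σ_{|U|=t} X_U ⪰ μ·C(n,t)·I` and `Σ_M Y_M ⪰ ν·|PM|·I`. (`→`: brick 84. `←`: a well-conditioned pair has value `≤ r·20·√P ≤ r·e^{−dq n}`
by bricks 87d and §1, so with `a' = min(a, 1)` both classes decay at rate `a'`.) [cite: Rothvoss2017, §2 (PDF pp. 5–7)]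
[cite: Grigoriev2001, Lemma 1.4 (PDF p. 8)] [cite: GriblingDelaatLaurent2019, §5] [cite: CoppersmithRivlin1992, Thm. (p. 970)] -/
theorem tracialDecayExp20_iff_illConditioned :
    Summit.PneNP.PneNP.Theses.ChebyshevTracialDesign.TracialDecayExp20 ↔
    ∃ a : ℝ, 0 < a ∧ ∃ n₁ : ℕ, ∀ n : ℕ, n₁ ≤ n → Even n → ∀ (t : ℕ) (C : Finset ℕ) (w : ℕ → ℝ),
      IsBalancedDesign n t (Tq n) (dq n) 20 C w → ∀ r : ℕ, 0 < r → (r : ℝ) ^ 2 * n < Real.exp (a * (dq n : ℝ)) →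
        ∀ (X : OddSet n → Matrix (Fin r) (Fin r) ℝ) (Y : PMatch n → Matrix (Fin r) (Fin r) ℝ),
          (∀ U, (X U).PosSemidef ∧ (1 - X U).PosSemidef) → (∀ M, (Y M).PosSemidef ∧ (1 - Y M).PosSemidef) →
          (¬ ∃ μ ν : ℝ, 0 < μ ∧ 0 < ν ∧ 64 / (n : ℝ) ≤ μ * ν ∧
              ((∑ U : OddSet n, if U.1.card = t then X U else 0) - (μ * (n.choose t : ℝ)) • (1 : Matrix (Fin r) (Fin r) ℝ)).PosSemidef ∧
              ((∑ M, Y M) - (ν * (Fintype.card (PMatch n) : ℝ)) • (1 : Matrix (Fin r) (Fin r) ℝ)).PosSemidef) →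
            (∑ U, ∑ M, levelWeight n t C w U M * (X U * Y M).trace) / r ≤ Real.exp (-(a * (dq n : ℝ))) := by
  constructor
  · intro hcrux
    obtain ⟨a, ha, n₁, h⟩ := contractionDecay_of_tracialDecayExp20 hcrux
    exact ⟨a, ha, n₁, fun n hn hev t C w hdes r hr hbud X Y hX hY _ => h n hn hev t C w hdes r hr hbud X Y hX hY⟩
  · rintro ⟨a, ha, n₁, h⟩
    refine tracialDecayExp20_of_contractionDecay ⟨min a 1, lt_min ha one_pos, max n₁ 50625, ?_⟩
    intro n hn hev t C w hdes r hr hbud X Y hX hY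
    have hn₁ : n₁ ≤ n := le_trans (le_max_left _ _) hn
    have hn0 : 50625 ≤ n := le_trans (le_max_right _ _) hn
    have hr' : (0 : ℝ) < r := by exact_mod_cast hr
    have hD0 : (0 : ℝ) ≤ (dq n : ℝ) := Nat.cast_nonneg _
    -- rate comparison `e^{−a D}, e^{−D} ≤ e^{−a' D}`
    have hmono : ∀ b : ℝ, min a 1 ≤ b → Real.exp (-(b * (dq n : ℝ))) ≤ Real.exp (-(min a 1 * (dq n : ℝ))) := fun b hb => by
      rw [Real.exp_le_exp]; nlinarith
    by_cases hwc : ∃ μ ν : ℝ, 0 < μ ∧ 0 < ν ∧ 64 / (n : ℝ) ≤ μ * ν ∧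
        ((∑ U : OddSet n, if U.1.card = t then X U else 0) - (μ * (n.choose t : ℝ)) • (1 : Matrix (Fin r) (Fin r) ℝ)).PosSemidef ∧
        ((∑ M, Y M) - (ν * (Fintype.card (PMatch n) : ℝ)) • (1 : Matrix (Fin r) (Fin r) ℝ)).PosSemidef
    · -- WELL-CONDITIONED: brick 87d + the tail threshold
      obtain ⟨μ, ν, hμ, hν, hμν, hXbar, hYbar⟩ := hwc
      obtain ⟨hex, _⟩ := hdes
      obtain ⟨c', rfl⟩ : ∃ c', t = 2 * c' + 1 := hex.1
      obtain ⟨hD, hD1, hD2⟩ := design_side_conditions hn0 hex.2.2.1 hex.2.1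
      have hval := value_le_tail_of_minDensity hev hex hD hD1 hD2 X Y hX hY hμ hν hμν hXbar hYbar
      have hBv : ∑ c ∈ C, |w c| ≤ 20 := hex.2.2.2.2.2.2
      have hsq0 : 0 ≤ Real.sqrt (∏ i ∈ range (dq n / 2 + 1), ((2 * i + 1 : ℝ) / ((n : ℝ) - 2 * i))) := Real.sqrt_nonneg _
      have htail := tail_le_exp_neg hn0
      have h1 : ∑ U, ∑ M, levelWeight n (2 * c' + 1) C w U M * (X U * Y M).trace ≤ (r : ℝ) * Real.exp (-(dq n : ℝ)) := by
        refine hval.trans (mul_le_mul_of_nonneg_left ?_ hr'.le)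
        nlinarith
      rw [div_le_iff₀ hr']
      have h2 := hmono 1 (min_le_right _ _)
      rw [one_mul] at h2
      nlinarith [Real.exp_pos (-(min a 1 * (dq n : ℝ)))]
    · -- ILL-CONDITIONED: the hypothesis at rate `a`
      have hbud' : (r : ℝ) ^ 2 * n < Real.exp (a * (dq n : ℝ)) :=
        hbud.trans_le (Real.exp_le_exp.2 (mul_le_mul_of_nonneg_right (min_le_left _ _) hD0))
      exact (h n hn₁ hev t C w hdes r hr hbud' X Y hX hY hwc).trans (hmono a (min_le_left _ _))

end Summit.PneNP.PneNP.Theorems.ChebyshevTracialDesignIllConditionedCrux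

end
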